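import Summits.HodgeConjecture.HodgeConjecture.Theses.TropicalWeilObstruction
import Summits.HodgeConjecture.HodgeConjecture.Theorems.TropicalWeilObstructionTropicalHodgeBoundCycleClassRational
import Summits.HodgeConjecture.HodgeConjecture.Theorems.TropicalWeilObstructionTropicalWeilVanishingSimplexDeterminants
import Summits.HodgeConjecture.HodgeConjecture.Theorems.TropicalWeilObstructionTropicalWeilVanishingIntegralityHomotopy
import Summits.HodgeConjecture.HodgeConjecture.Theorems.TropicalWeilObstructionTropicalWeilVanishingIntegralitySorting
import HarnessLib

/-!
# Route `TropicalWeilObstruction` (Kontsevich's tropical test — NEGATION SINK, exploration, no summit claim):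
# full integrality of the tropical cycle class — III. `24 ∣ intCoord Z`

Negation-sink bookkeeping of the cell `pub-hodge-tropical` (seat tropical-2 gen 6); part III of three of FULL INTEGRALITY
(parts I–II: `…IntegralityHomotopy` p344721, `…IntegralitySorting`). K3 (p322554, `cyc_eq_sum_det_mul_intCoord`) writes the
class of an effective tropical `4`-cycle `Z` on `ℝᵍ/Qℤᵍ` as `cyc Z (S,S') = 576⁻¹ Σ_I det Q[S,I] · intCoord Z (I,S')` with the
INTEGER table `intCoord Z (I,S') = Σ_σ w_σ Δ_{S'}(L_σ) · det[ū_{σ,j+1} - ū_{σ,0}]_I`, `ū = ⌊Q⁻¹v⌋` the floored period coordinates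
of the vertices; topologically `[Z] ∈ H₄(X_Q; ⋀⁴ℤᵍ) = ⋀⁴(Qℤᵍ) ⊗ ⋀⁴ℤᵍ` [cite: MikhalkinZharkov2014Eigenwave, Prop. 4.3], i.e.
`24 ∣ intCoord Z`; the tree had the factor `4` (tropical-1's `Ladder.four_dvd_intCoord`, one algebraic Stokes step). Here:

* **`twentyFour_dvd_intCoord`** — `24 ∣ intCoord Z (I,S')` for every effective tropical `4`-cycle on `ℝᵍ/Qℤᵍ` (`det Q ≠ 0`,
  any `g`) and all words `I, S'`. Proof ("sort once"): read the floored vertices as points of `ℤᵍ` in the translation-invariant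
  LEXICOGRAPHIC order (`Lex (Fin g → ℤ)`); part II's `antisymmetrisation_identity` fed with part I's homotopy `D = 24·C + δΨ`
  gives, pointwise on `5`-tuples, `det[ū_{j+1} - ū_0]_I = 24·𝐀C_I(ū) + Σ_i (-1)^i 𝐀Ψ_I(ū∘δ_i)` with `𝐀Ψ_I` ALTERNATING,
  TRANSLATION INVARIANT and `ℤ`-valued; summing over the cells with the weights `w_σ Δ_{S'}(L_σ)`, the facets of one class are
  `ℤᵍ`-translates of the re-ordered floored reference facet (`facet_eq`, `⌊x + k⌋ = ⌊x⌋ + k`), so the `𝐀Ψ_I` terms are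
  `± 𝐀Ψ_I(reference facet)` and cancel class by class (`balanced`) — exactly as in `Ladder.intCoord_eq_four_mul`;
* `cyc_eq_sum_det_mul_intCoord_div` — `cyc Z (S,S') = 24⁻¹ Σ_I det Q[S,I] · (intCoord Z (I,S') / 24)` with an integer quotient:
  the class lies in the image of `⋀⁴(Qℤᵍ) ⊗ ⋀⁴ℤᵍ`.

Consequences (separate file, with tropical-1's `…DegreeLadder`, p344212): at a Weil-generic period `cyc Z ∈ ℤθ₄ ⊕ ℤRe w ⊕ ℤIm w`
(effective classes are INTEGRAL Hodge classes), and the ladder's rung `q₀ < 8 ⟹ W(Z) = 0` holds unconditionally.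

HONEST STATUS. A structural fact about the certificate format; decides nothing about K1 (`TropicalWeilVanishing`,
stmt-HodgeConjecture-18478, an OPEN problem) or about the Hodge conjecture. No definition (display-only notation), no named
fact, no sorry.

References: [MikhalkinZharkov2014Eigenwave] G. Mikhalkin, I. Zharkov, Tropical eigenwave and intermediate Jacobians,
LN UMI 15 (2014), Def. 4.2, Prop. 4.3; [Zharkov2020TropicalWeil] I. Zharkov, arXiv:2002.02347, p. 2 ("`vol(Z) ∈ ⋀ᵖΓ₁ ⊗ ⋀ᵖΓ₂`").
-/

set_option linter.dupNamespace false

noncomputable section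

open scoped BigOperators
open Matrix
open Literature.AlgebraicGeometry.Tropical
open Summit.HodgeConjecture.HodgeConjecture.Theorems.TropicalHodgeBound

namespace Summit.HodgeConjecture.HodgeConjecture.Theorems.TropicalWeilVanishing.Integrality

/-! ## §0 Display-only notation (verbatim copies of parts I–II; nothing is defined) -/

/-- The cup product of part I. Nothing is defined. -/
local notation3 (prettyPrint := false) "𝐂⟦" x "⟧" =>
  (∏ a : Fin 4, (x (Fin.succ a) a - x (Fin.castSucc a) a))

/-- The cup-product homotopy of part I (`23` monomials). Nothing is defined. -/
local notation3 (prettyPrint := false) "𝚿⟦" y "⟧" =>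
  ((9) * ((y 1 0 - y 0 0) * (y 1 1 - y 0 1) * (y 2 2 - y 1 2) * (y 3 3 - y 2 3)) +
    (-3) * ((y 1 0 - y 0 0) * (y 1 1 - y 0 1) * (y 3 2 - y 2 2) * (y 2 3 - y 1 3)) +
    (-1) * ((y 1 0 - y 0 0) * (y 2 1 - y 1 1) * (y 1 2 - y 0 2) * (y 3 3 - y 2 3)) +
    (-8) * ((y 1 0 - y 0 0) * (y 2 1 - y 1 1) * (y 2 2 - y 1 2) * (y 3 3 - y 2 3)) +
    (1) * ((y 1 0 - y 0 0) * (y 2 1 - y 1 1) * (y 3 2 - y 2 2) * (y 1 3 - y 0 3)) +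
    (2) * ((y 1 0 - y 0 0) * (y 2 1 - y 1 1) * (y 3 2 - y 2 2) * (y 2 3 - y 1 3)) +
    (6) * ((y 1 0 - y 0 0) * (y 2 1 - y 1 1) * (y 3 2 - y 2 2) * (y 3 3 - y 2 3)) +
    (3) * ((y 1 0 - y 0 0) * (y 3 1 - y 2 1) * (y 1 2 - y 0 2) * (y 2 3 - y 1 3)) +
    (-1) * ((y 1 0 - y 0 0) * (y 3 1 - y 2 1) * (y 2 2 - y 1 2) * (y 1 3 - y 0 3)) +
    (-2) * ((y 1 0 - y 0 0) * (y 3 1 - y 2 1) * (y 2 2 - y 1 2) * (y 2 3 - y 1 3)) +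
    (-6) * ((y 1 0 - y 0 0) * (y 3 1 - y 2 1) * (y 2 2 - y 1 2) * (y 3 3 - y 2 3)) +
    (1) * ((y 2 0 - y 1 0) * (y 1 1 - y 0 1) * (y 1 2 - y 0 2) * (y 3 3 - y 2 3)) +
    (8) * ((y 2 0 - y 1 0) * (y 1 1 - y 0 1) * (y 2 2 - y 1 2) * (y 3 3 - y 2 3)) +
    (-1) * ((y 2 0 - y 1 0) * (y 1 1 - y 0 1) * (y 3 2 - y 2 2) * (y 1 3 - y 0 3)) +
    (-2) * ((y 2 0 - y 1 0) * (y 1 1 - y 0 1) * (y 3 2 - y 2 2) * (y 2 3 - y 1 3)) +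
    (1) * ((y 2 0 - y 1 0) * (y 3 1 - y 2 1) * (y 1 2 - y 0 2) * (y 1 3 - y 0 3)) +
    (2) * ((y 2 0 - y 1 0) * (y 3 1 - y 2 1) * (y 1 2 - y 0 2) * (y 2 3 - y 1 3)) +
    (-3) * ((y 3 0 - y 2 0) * (y 1 1 - y 0 1) * (y 1 2 - y 0 2) * (y 2 3 - y 1 3)) +
    (1) * ((y 3 0 - y 2 0) * (y 1 1 - y 0 1) * (y 2 2 - y 1 2) * (y 1 3 - y 0 3)) +
    (2) * ((y 3 0 - y 2 0) * (y 1 1 - y 0 1) * (y 2 2 - y 1 2) * (y 2 3 - y 1 3)) +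
    (6) * ((y 3 0 - y 2 0) * (y 1 1 - y 0 1) * (y 2 2 - y 1 2) * (y 3 3 - y 2 3)) +
    (-1) * ((y 3 0 - y 2 0) * (y 2 1 - y 1 1) * (y 1 2 - y 0 2) * (y 1 3 - y 0 3)) +
    (-2) * ((y 3 0 - y 2 0) * (y 2 1 - y 1 1) * (y 1 2 - y 0 2) * (y 2 3 - y 1 3)))

open Classical in
/-- Antisymmetrisation on `5`-tuples (part II). Nothing is defined. -/
local notation3 (prettyPrint := false) "𝐀₅⟦" G "," x "⟧" =>
  (∑ ρ : Equiv.Perm (Fin 5),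
    (if StrictMono (x ∘ ⇑ρ) then ((Equiv.Perm.sign ρ : ℤˣ) : ℤ) * G (x ∘ ⇑ρ) else (0 : ℤ)))

open Classical in
/-- Antisymmetrisation on `4`-tuples (part II). Nothing is defined. -/
local notation3 (prettyPrint := false) "𝐀₄⟦" H "," y "⟧" =>
  (∑ ρ : Equiv.Perm (Fin 4),
    (if StrictMono (y ∘ ⇑ρ) then ((Equiv.Perm.sign ρ : ℤˣ) : ℤ) * H (y ∘ ⇑ρ) else (0 : ℤ)))

/-! ## §1 The chain: `24 ∣ intCoord Z` -/

section Chain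

variable {g : ℕ} {Q : Matrix (Fin g) (Fin g) ℝ}

/-- **`24 ∣ intCoord Z (I,S')`** for every effective tropical `4`-cycle on `ℝᵍ/Qℤᵍ` (`det Q ≠ 0`, any `g`) and all words
`I, S'`: the integer class table of K3 is divisible by `24` — full integrality `[Z] ∈ ⋀⁴(Qℤᵍ) ⊗ ⋀⁴ℤᵍ` of the tropical cycle
class in the certificate format (sort-once proof: cup-product homotopy + lexicographic antisymmetrisation + `balanced`).
[cite: MikhalkinZharkov2014Eigenwave, Prop. 4.3] -/
theorem twentyFour_dvd_intCoord (hQ : IsUnit Q.det) (Z : TropicalTorusCycle g 4 Q) (I S' : Fin 4 → Fin g) :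
    (24 : ℤ) ∣ intCoord Z I S' := by
  classical
  -- the three cochains on `5`-/`4`-tuples of points of `ℤᵍ` in the LEXICOGRAPHIC order, read in the coordinates `I`
  let F : (Fin 5 → Lex (Fin g → ℤ)) → ℤ := fun x =>
    (Matrix.of fun (j : Fin 4) (a : Fin 4) => ofLex (x j.succ) (I a) - ofLex (x 0) (I a)).det
  let G : (Fin 5 → Lex (Fin g → ℤ)) → ℤ := fun x => 𝐂⟦fun (k : Fin 5) (a : Fin 4) => ofLex (x k) (I a)⟧
  let H : (Fin 4 → Lex (Fin g → ℤ)) → ℤ := fun y => 𝚿⟦fun (k : Fin 4) (a : Fin 4) => ofLex (y k) (I a)⟧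
  have hF : ∀ (x : Fin 5 → Lex (Fin g → ℤ)) (τ : Equiv.Perm (Fin 5)),
      F (x ∘ ⇑τ) = ((Equiv.Perm.sign τ : ℤˣ) : ℤ) * F x := by
    intro x τ
    exact det_sub_perm (fun (k : Fin 5) (a : Fin 4) => ofLex (x k) (I a)) τ
  have hid : ∀ x : Fin 5 → Lex (Fin g → ℤ), StrictMono x →
      F x = 24 * G x + ∑ i : Fin 5, (-1 : ℤ) ^ (i : ℕ) * H (x ∘ i.succAbove) := by
    intro x _
    exact det_sub_eq_cup_add_homotopy (fun (k : Fin 5) (a : Fin 4) => ofLex (x k) (I a))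
  have hH : ∀ (y : Fin 4 → Lex (Fin g → ℤ)) (t : Lex (Fin g → ℤ)), H (fun k => y k + t) = H y := by
    intro y t
    exact homotopy_add_const (fun (k : Fin 4) (a : Fin 4) => ofLex (y k) (I a)) (fun a => ofLex t (I a))
  -- the antisymmetrised cochains, treated as black boxes from here on
  have key := antisymmetrisation_identity F G H hF hid
  set A : (Fin 5 → Lex (Fin g → ℤ)) → ℤ := fun x => 𝐀₅⟦G, x⟧ with hA
  set Φ : (Fin 4 → Lex (Fin g → ℤ)) → ℤ := fun y => 𝐀₄⟦H, y⟧ with hΦ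
  have halt : ∀ (y : Fin 4 → Lex (Fin g → ℤ)) (τ : Equiv.Perm (Fin 4)),
      Φ (y ∘ ⇑τ) = ((Equiv.Perm.sign τ : ℤˣ) : ℤ) * Φ y := fun y τ => antisym₄_comp_perm H y τ
  have htr : ∀ (y : Fin 4 → Lex (Fin g → ℤ)) (t : Lex (Fin g → ℤ)), Φ (fun k => y k + t) = Φ y := fun y t => antisym₄_add_const H hH y t
  have key' : ∀ x : Fin 5 → Lex (Fin g → ℤ), F x = 24 * A x + ∑ i : Fin 5, (-1 : ℤ) ^ (i : ℕ) * Φ (x ∘ i.succAbove) :=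
    fun x => key x
  clear_value A Φ
  -- floored period coordinates of the vertices and of the reference facets, as lexicographic vectors
  let u : Fin Z.numCells → Fin 5 → Lex (Fin g → ℤ) := fun σ k => toLex fun r => ⌊(Q⁻¹ *ᵥ (Z.cell σ).vertex k) r⌋
  let ρ : Fin Z.numFacetClasses → Fin 4 → Lex (Fin g → ℤ) := fun f j => toLex fun r => ⌊(Q⁻¹ *ᵥ Z.refFacet f j) r⌋
  let t : Fin Z.numCells → Fin 5 → Lex (Fin g → ℤ) := fun σ i => toLex (Z.facetShift σ i)
  -- the facets are integer translates of the reference facets, re-ordered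
  have hfacet : ∀ σ i, u σ ∘ i.succAbove =
      (fun j => ρ (Z.facetClass σ i) j + t σ i) ∘ ⇑(Z.facetPerm σ i)⁻¹ := by
    intro σ i
    funext j
    simp only [Function.comp_apply]
    have hv : ∀ j', (Z.cell σ).vertex (i.succAbove (Z.facetPerm σ i j')) =
        Z.refFacet (Z.facetClass σ i) j' + Q *ᵥ fun b => (Z.facetShift σ i b : ℝ) := by
      intro j'; funext a; rw [Z.facet_eq σ i j' a]; rfl
    have hj : i.succAbove j = i.succAbove (Z.facetPerm σ i ((Z.facetPerm σ i)⁻¹ j)) := by simp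
    rw [hj]
    change toLex (fun r => ⌊(Q⁻¹ *ᵥ (Z.cell σ).vertex (i.succAbove (Z.facetPerm σ i ((Z.facetPerm σ i)⁻¹ j)))) r⌋) =
      toLex (fun r => ⌊(Q⁻¹ *ᵥ Z.refFacet (Z.facetClass σ i) ((Z.facetPerm σ i)⁻¹ j)) r⌋) + toLex (Z.facetShift σ i)
    rw [hv, ← toLex_add]
    congr 1
    funext r
    simp only [Matrix.mulVec_add, Matrix.mulVec_mulVec, Matrix.nonsing_inv_mul Q hQ, Matrix.one_mulVec,
      Pi.add_apply, Int.floor_add_intCast]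
  -- the face terms: `Φ(u_σ ∘ δ_i) = sign(π_{σ,i}) · Φ(ρ̄_{f(σ,i)})`
  have hface : ∀ σ i, Φ (u σ ∘ i.succAbove) = ((Equiv.Perm.sign (Z.facetPerm σ i) : ℤˣ) : ℤ) * Φ (ρ (Z.facetClass σ i)) := by
    intro σ i
    rw [hfacet, halt, htr, Equiv.Perm.sign_inv]
  -- the face terms cancel class by class (`balanced`)
  set n : Fin Z.numCells → ℤ := fun σ => ((Z.cell σ).weight : ℤ) * pluckerCoord (Z.cell σ).frame S' with hn
  have hbal : ∑ σ, ∑ i : Fin 5, n σ * (-1 : ℤ) ^ (i : ℕ) * (((Equiv.Perm.sign (Z.facetPerm σ i) : ℤˣ) : ℤ) *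
      Φ (ρ (Z.facetClass σ i))) = 0 := by
    have hreg : ∀ σ (i : Fin 5), n σ * (-1 : ℤ) ^ (i : ℕ) * (((Equiv.Perm.sign (Z.facetPerm σ i) : ℤˣ) : ℤ) *
        Φ (ρ (Z.facetClass σ i))) =
        ∑ f, Φ (ρ f) * (if Z.facetClass σ i = f then
          ((Z.cell σ).weight : ℤ) * (-1) ^ (i : ℕ) * ((Equiv.Perm.sign (Z.facetPerm σ i) : ℤˣ) : ℤ) *
            pluckerCoord (Z.cell σ).frame S' else 0) := by
      intro σ i
      rw [Finset.sum_eq_single (Z.facetClass σ i)]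
      · rw [if_pos rfl, hn]; ring
      · intro f _ hf; rw [if_neg (Ne.symm hf), mul_zero]
      · intro h; exact absurd (Finset.mem_univ _) h
    simp_rw [hreg]
    calc ∑ σ, ∑ i : Fin 5, ∑ f, Φ (ρ f) * (if Z.facetClass σ i = f then
            ((Z.cell σ).weight : ℤ) * (-1) ^ (i : ℕ) * ((Equiv.Perm.sign (Z.facetPerm σ i) : ℤˣ) : ℤ) *
              pluckerCoord (Z.cell σ).frame S' else 0)
        = ∑ σ, ∑ f, ∑ i : Fin 5, Φ (ρ f) * (if Z.facetClass σ i = f then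
            ((Z.cell σ).weight : ℤ) * (-1) ^ (i : ℕ) * ((Equiv.Perm.sign (Z.facetPerm σ i) : ℤˣ) : ℤ) *
              pluckerCoord (Z.cell σ).frame S' else 0) := Finset.sum_congr rfl fun σ _ => Finset.sum_comm
      _ = ∑ f, ∑ σ, ∑ i : Fin 5, Φ (ρ f) * (if Z.facetClass σ i = f then
            ((Z.cell σ).weight : ℤ) * (-1) ^ (i : ℕ) * ((Equiv.Perm.sign (Z.facetPerm σ i) : ℤˣ) : ℤ) *
              pluckerCoord (Z.cell σ).frame S' else 0) := Finset.sum_comm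
      _ = ∑ f, Φ (ρ f) * ∑ σ, ∑ i : Fin 5, (if Z.facetClass σ i = f then
            ((Z.cell σ).weight : ℤ) * (-1) ^ (i : ℕ) * ((Equiv.Perm.sign (Z.facetPerm σ i) : ℤˣ) : ℤ) *
              pluckerCoord (Z.cell σ).frame S' else 0) := by
          refine Finset.sum_congr rfl fun f _ => ?_
          rw [Finset.mul_sum]
          exact Finset.sum_congr rfl fun σ _ => by rw [Finset.mul_sum]
      _ = 0 := Finset.sum_eq_zero fun f _ => by rw [Z.balanced f S', mul_zero]
  -- assemble
  refine ⟨∑ σ, n σ * A (u σ), ?_⟩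
  unfold intCoord
  calc ∑ σ, ((Z.cell σ).weight : ℤ) * pluckerCoord (Z.cell σ).frame S' *
        (Matrix.of fun (j : Fin 4) (a : Fin 4) =>
          ⌊(Q⁻¹ *ᵥ (Z.cell σ).vertex j.succ) (I a)⌋ - ⌊(Q⁻¹ *ᵥ (Z.cell σ).vertex 0) (I a)⌋).det
      = ∑ σ, n σ * F (u σ) := Finset.sum_congr rfl fun σ _ => rfl
    _ = ∑ σ, (24 * (n σ * A (u σ)) + ∑ i : Fin 5, n σ * (-1 : ℤ) ^ (i : ℕ) *
          (((Equiv.Perm.sign (Z.facetPerm σ i) : ℤˣ) : ℤ) * Φ (ρ (Z.facetClass σ i)))) := by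
        refine Finset.sum_congr rfl fun σ _ => ?_
        rw [key' (u σ), mul_add, Finset.mul_sum]
        congr 1
        · ring
        · exact Finset.sum_congr rfl fun i _ => by rw [hface σ i]; ring
    _ = 24 * ∑ σ, n σ * A (u σ) + ∑ σ, ∑ i : Fin 5, n σ * (-1 : ℤ) ^ (i : ℕ) *
          (((Equiv.Perm.sign (Z.facetPerm σ i) : ℤˣ) : ℤ) * Φ (ρ (Z.facetClass σ i))) := by
        rw [Finset.sum_add_distrib, Finset.mul_sum]
    _ = 24 * ∑ σ, n σ * A (u σ) := by rw [hbal, add_zero]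

/-- **The cycle class is integral**: `cyc Z (S,S') = 24⁻¹ Σ_I det Q[S,I] · (intCoord Z (I,S') / 24)`, the quotient being
an integer — `[Z] ∈ ⋀⁴(Qℤᵍ) ⊗ ⋀⁴ℤᵍ` in coordinates. [cite: MikhalkinZharkov2014Eigenwave, Prop. 4.3] -/
theorem cyc_eq_sum_det_mul_intCoord_div (hQ : IsUnit Q.det) (Z : TropicalTorusCycle g 4 Q)
    (S S' : Fin 4 → Fin g) :
    Z.cyc S S' = (1 / 24 : ℝ) * ∑ I : Fin 4 → Fin g,
      (Q.submatrix S I).det * ((intCoord Z I S' / 24 : ℤ) : ℝ) := by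
  rw [cyc_eq_sum_det_mul_intCoord hQ Z S S',
    show (1 / 576 : ℝ) = (1 / 24 : ℝ) * (1 / 24 : ℝ) by norm_num, mul_assoc, Finset.mul_sum]
  congr 1
  refine Finset.sum_congr rfl fun I _ => ?_
  have h24 := Int.ediv_mul_cancel (twentyFour_dvd_intCoord hQ Z I S')
  have hc : ((intCoord Z I S' : ℤ) : ℝ) = ((intCoord Z I S' / 24 : ℤ) : ℝ) * 24 := by
    exact_mod_cast h24.symm
  rw [hc]
  ring

end Chain

end Summit.HodgeConjecture.HodgeConjecture.Theorems.TropicalWeilVanishing.Integrality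

end
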